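import Mathlib
import HarnessLib
import Summits.NavierStokesRegularity.NavierStokesRegularity.Theorems.TaylorModelRungThreeVDefs
import Summits.NavierStokesRegularity.NavierStokesRegularity.Theorems.TaylorModelRungThreeReadoutFlowVHigh
import Summits.NavierStokesRegularity.NavierStokesRegularity.Theorems.TaylorModelRungThreeReadoutFlowVDeriv
import Summits.NavierStokesRegularity.NavierStokesRegularity.Theorems.TaylorModelRungThreeReadoutFlowVFDeriv
import Summits.NavierStokesRegularity.NavierStokesRegularity.Theorems.TaylorModelRungThreeSoundnessVectorMeanValue

/-!
# Line `taylor-model` on crux K1b-DR (stmt-NavierStokesRegularity-23954) — (E) ASSEMBLED: the v3 flow package of the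
# selector flow from the flow-side chain predicate, `StageNumerics → ChainVCore → IsFlowPackageV`

The v3 (vector-step / C¹-Lohner) analogue of stub G0i (`FlowPackageExists`): for a certificate `cd` with companion boxes
`bx` (`…TaylorModelRungThreeVDefs`, p620175), the stage data of `StageNumerics` (positive gauges, the bilinear bound (B))
and the flow-side chain clauses `ChainVCore cd bx` give the flow package `IsFlowPackageV cd bx φ` for THE selector flow
`φ j := liftFlow cd (flowSel (Qw cd))` — no `TaylorModelSoundness` hypothesis, no step restriction.  Clause by clause from
the landed files `…ReadoutFlowV` (F0, F2, F1′/F5′ under (E1)), `…ReadoutFlowVHigh` ((E2) branch), `…ReadoutFlowVDiff`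
(F3′), `…ReadoutFlowVDeriv` (F4′), `…ReadoutFlowVFDeriv` (F7′) and `…SoundnessVectorMeanValue` (F8′).

* `solvesOn_of_isSolOn_flowSel`, `inTube_of_inBox`, `inTube2_of_inTube`, `toVec_basisSt` — plumbing;
* `stepFactsV` — the per-sub-step package clauses from the per-sub-step `ChainVCore` clauses (explicit form);
* `isFlowPackageV_of_core` — the assembled statement.

MODEL-lattice rung TL-M3 only; nothing here is a statement about the Navier–Stokes equations.
-/

noncomputable section

-- the sub-problem namespace repeats the summit name by design (D-0017)
set_option linter.dupNamespace false

namespace Summit.NavierStokesRegularity.NavierStokesRegularity.Theorems.TaylorModelV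

open Set Finset
open Literature.Analysis.FluidPDE.TaoCascade Literature.Analysis.FluidPDE.TaoCascade.TaylorChain
open Summit.NavierStokesRegularity.NavierStokesRegularity.Theorems.TaylorModelMajorant
open Summit.NavierStokesRegularity.NavierStokesRegularity.Theorems.TaylorModelVector
open Summit.NavierStokesRegularity.NavierStokesRegularity.Theorems.TaylorModelReadout

variable {cd : CertData} {bx : StepBoxes}

/-! ### Plumbing -/

/-- Window-side `IsSolOn` of the selector gives the cascade-side `SolvesOn` of the selector flow. [folklore] -/
theorem solvesOn_of_isSolOn_flowSel {j : ℕ} {x : Fin 4 → ℤ → ℝ} {h : ℝ}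
    (hsol : IsSolOn (Qw cd) (toVec cd x) h (fun s => flowSel (Qw cd) (toVec cd x) s)) :
    SolvesOn cd (fun _ => liftFlow cd (fun x s => flowSel (Qw cd) x s)) j x h := by
  intro i k hk1 hk2
  have hk : -cd.Kb ≤ k ∧ k ≤ cd.Ka := ⟨hk1, hk2⟩
  refine ⟨liftFlowSel_zero x i hk, fun t' ht' => ?_⟩
  set c : Fin (nW cd) := eW cd (i, ⟨k, Finset.mem_Icc.2 hk⟩) with hc
  have hcomp : HasDerivWithinAt (fun s => flowSel (Qw cd) (toVec cd x) s c)
      (Qw cd (flowSel (Qw cd) (toVec cd x) t') (flowSel (Qw cd) (toVec cd x) t') c) (Icc 0 h) t' :=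
    (hasDerivWithinAt_pi.1 (hsol.2 t' ht')) c
  have hfun : (fun s => liftFlow cd (fun x s => flowSel (Qw cd) x s) x i k s) =
      fun s => flowSel (Qw cd) (toVec cd x) s c := by
    funext s; rw [liftFlow_of_mem x i hk]
  rw [show (fun _ => liftFlow cd (fun x s => flowSel (Qw cd) x s)) j x i k =
      fun s => liftFlow cd (fun x s => flowSel (Qw cd) x s) x i k s from rfl, hfun]
  convert hcomp using 1
  rw [quadTerm_trunc_eq_qT (cd := cd) _ i hk, qT_eq_Qw_apply (cd := cd) _ i hk]
  congr 1 <;>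
  · funext c'
    simp only [toVec]
    rw [liftFlow_of_mem _ _ (shellOf_mem cd c')]
    congr 1
    exact (Equiv.apply_symm_apply (eW cd) c')

/-- The state box lies in the tube box (`loK ≤ 0 ≤ hiK`). [folklore] -/
theorem inTube_of_inBox {j s : ℕ} (hK0 : ∀ i k, -cd.Kb ≤ k → k ≤ cd.Ka → bx.loK j s i k ≤ 0 ∧ 0 ≤ bx.hiK j s i k)
    {y : Fin 4 → ℤ → ℝ} (hy : InBox cd (bx.lo j s) (bx.hi j s) y) : InTube cd bx j s y := by
  intro i k hk1 hk2
  have h1 := hy i k hk1 hk2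
  have h2 := hK0 i k hk1 hk2
  simp only [Pi.add_apply]
  exact ⟨by linarith [h1.1, h2.1], by linarith [h1.2, h2.2]⟩

/-- The tube box lies in the doubled tube box. [folklore] -/
theorem inTube2_of_inTube {j s : ℕ} (hK0 : ∀ i k, -cd.Kb ≤ k → k ≤ cd.Ka → bx.loK j s i k ≤ 0 ∧ 0 ≤ bx.hiK j s i k)
    {y : Fin 4 → ℤ → ℝ} (hy : ∀ i k, -cd.Kb ≤ k → k ≤ cd.Ka →
      (bx.lo j s + bx.loK j s) i k ≤ y i k ∧ y i k ≤ (bx.hi j s + bx.hiK j s) i k) :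
    InBox cd (bx.lo j s + bx.loK j s + bx.loK j s) (bx.hi j s + bx.hiK j s + bx.hiK j s) y := by
  intro i k hk1 hk2
  have h1 := hy i k hk1 hk2
  have h2 := hK0 i k hk1 hk2
  simp only [Pi.add_apply] at h1 ⊢
  exact ⟨by linarith [h1.1, h2.1], by linarith [h1.2, h2.2]⟩

/-- The window vector of the basis state `e_(i,k)` is the basis vector `e_c`, `c = eW (i,k)`. [folklore] -/
theorem toVec_basisSt (i : Fin 4) {k : ℤ} (hk : -cd.Kb ≤ k ∧ k ≤ cd.Ka) :
    toVec cd (basisSt i k) = Pi.single (eW cd (i, ⟨k, Finset.mem_Icc.2 hk⟩)) 1 := by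
  funext c
  by_cases hc : c = eW cd (i, ⟨k, Finset.mem_Icc.2 hk⟩)
  · subst hc
    simp [toVec, basisSt, modeOf, shellOf]
  · rw [Pi.single_eq_of_ne hc]
    simp only [toVec, basisSt]
    rw [if_neg]
    intro hmk
    apply hc
    have e : (modeOf cd c, (⟨shellOf cd c, Finset.mem_Icc.2 (shellOf_mem cd c)⟩ : Finset.Icc (-cd.Kb) cd.Ka)) =
        (i, ⟨k, Finset.mem_Icc.2 hk⟩) := Prod.ext hmk.1 (Subtype.ext hmk.2)
    have e2 : eW cd (modeOf cd c, ⟨shellOf cd c, Finset.mem_Icc.2 (shellOf_mem cd c)⟩) = c := by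
      simp [modeOf, shellOf]
    rw [← e2, e]


/-! ### The assembled package -/

/-- **(E) ASSEMBLED — `StageNumerics → ChainVCore → IsFlowPackageV` for the selector flow.** [folklore] -/
theorem isFlowPackageV_of_core (hSN : cd.StageNumerics) (hC : ChainVCore cd bx) :
    IsFlowPackageV cd bx (fun _ => liftFlow cd (fun x s => flowSel (Qw cd) x s)) := by
  refine ⟨fun j z i k t => rfl, fun j hj => ?_⟩
  -- stage data
  have hω : ∀ k, 0 < cd.ω j k := (hSN.1 j hj).2.2.2.2.2.2.1
  have hbb : 0 ≤ cd.bb j := (hSN.2 j hj).1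
  have hB := (hSN.2 j hj).2
  have hMS := majorantQw (cd := cd) hω hbb hB
  obtain ⟨-, -, hnode, hstep⟩ := hC j hj
  refine ⟨fun z i k hk t => liftFlowSel_off_window z i hk t, fun z T ψ _ hψ => liftFlowSel_unique hMS hψ, ?_⟩
  intro s' hs'
  obtain ⟨hh, -, hE, hJ, hK0, hKtest, hKrow, hVincl, hVtest, hVrow, hJU, hM⟩ := hstep s' hs'
  have hh' : 0 ≤ cd.h j s' := hh.le
  -- abbreviations
  set lo := bx.lo j s' with hlo_def
  set hi := bx.hi j s' with hhi_def
  set loK := bx.loK j s'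
  set hiK := bx.hiK j s'
  set loV := bx.loV j s'
  set hiV := bx.hiV j s'
  have hK00 : ∀ i k, -cd.Kb ≤ k → k ≤ cd.Ka → bx.loK j s' i k ≤ 0 ∧ 0 ≤ bx.hiK j s' i k :=
    fun i k hk1 hk2 => ⟨(hK0 i k hk1 hk2).1, (hK0 i k hk1 hk2).2.1⟩
  have hKκ : ∀ i k, -cd.Kb ≤ k → k ≤ cd.Ka →
      bx.loK j s' i k ≤ -(cd.κ j * cd.ω j k) ∧ cd.κ j * cd.ω j k ≤ bx.hiK j s' i k :=
    fun i k hk1 hk2 => ⟨(hK0 i k hk1 hk2).2.2.1, (hK0 i k hk1 hk2).2.2.2⟩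
  -- the state-jet enclosure restricted to the state box
  have hJB : ∀ y : Fin 4 → ℤ → ℝ, (∀ i k, -cd.Kb ≤ k → k ≤ cd.Ka → lo i k ≤ y i k ∧ y i k ≤ hi i k) →
      ∀ i k, -cd.Kb ≤ k → k ≤ cd.Ka → |taylorJet cd.Qb y (cd.pdeg + 1) i k| ≤ bx.J j s' i k :=
    fun y hy => hJ y (inTube_of_inBox hK00 hy)
  -- the κ-difference test restricted to the state box
  have hKtestB : ∀ d₀ : Fin 4 → ℤ → ℝ, cd.InBall j d₀ (cd.κ j) → ∀ y d : Fin 4 → ℤ → ℝ,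
      (∀ i k, -cd.Kb ≤ k → k ≤ cd.Ka → lo i k ≤ y i k ∧ y i k ≤ hi i k) →
      (∀ i k, -cd.Kb ≤ k → k ≤ cd.Ka → loK i k ≤ d i k ∧ d i k ≤ hiK i k) → ∀ u ∈ Icc (0:ℝ) (cd.h j s'),
        ∀ i k, -cd.Kb ≤ k → k ≤ cd.Ka →
          loK i k ≤ (d₀ + u • (cd.Qb y d + cd.Qb d y + cd.Qb d d)) i k ∧
          (d₀ + u • (cd.Qb y d + cd.Qb d y + cd.Qb d d)) i k ≤ hiK i k :=
    fun d₀ hd₀ y d hy hd u hu => hKtest d₀ hd₀ y d (inTube_of_inBox hK00 hy) hd u hu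
  -- the variational test / jets restricted to the tube box
  have hVtestT : ∀ v₀ : Fin 4 → ℤ → ℝ, cd.InBall j v₀ 1 → ∀ y v : Fin 4 → ℤ → ℝ,
      (∀ i k, -cd.Kb ≤ k → k ≤ cd.Ka → (lo + loK) i k ≤ y i k ∧ y i k ≤ (hi + hiK) i k) →
      (∀ i k, -cd.Kb ≤ k → k ≤ cd.Ka → loV i k ≤ v i k ∧ v i k ≤ hiV i k) → ∀ u ∈ Icc (0:ℝ) (cd.h j s'),
        ∀ i k, -cd.Kb ≤ k → k ≤ cd.Ka →
          loV i k ≤ (v₀ + u • (cd.Qb y v + cd.Qb v y)) i k ∧ (v₀ + u • (cd.Qb y v + cd.Qb v y)) i k ≤ hiV i k :=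
    fun v₀ hv₀ y v hy hv u hu => hVtest v₀ hv₀ y v (inTube2_of_inTube hK00 hy) hv u hu
  have hJUT : ∀ y v : Fin 4 → ℤ → ℝ, (∀ i k, -cd.Kb ≤ k → k ≤ cd.Ka → (lo + loK) i k ≤ y i k ∧ y i k ≤ (hi + hiK) i k) →
      (∀ i k, -cd.Kb ≤ k → k ≤ cd.Ka → loV i k ≤ v i k ∧ v i k ≤ hiV i k) →
      ∀ i k, -cd.Kb ≤ k → k ≤ cd.Ka → |varJet cd.Qb y v (bx.pdegV + 1) i k| ≤ bx.JU j s' i k :=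
    fun y v hy hv => hJU y v (inTube2_of_inTube hK00 hy) hv
  have hVtestB : ∀ v₀ : Fin 4 → ℤ → ℝ, cd.InBall j v₀ 1 → ∀ y v : Fin 4 → ℤ → ℝ,
      (∀ i k, -cd.Kb ≤ k → k ≤ cd.Ka → lo i k ≤ y i k ∧ y i k ≤ hi i k) →
      (∀ i k, -cd.Kb ≤ k → k ≤ cd.Ka → loV i k ≤ v i k ∧ v i k ≤ hiV i k) → ∀ u ∈ Icc (0:ℝ) (cd.h j s'),
        ∀ i k, -cd.Kb ≤ k → k ≤ cd.Ka →
          loV i k ≤ (v₀ + u • (cd.Qb y v + cd.Qb v y)) i k ∧ (v₀ + u • (cd.Qb y v + cd.Qb v y)) i k ≤ hiV i k :=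
    fun v₀ hv₀ y v hy hv u hu => hVtestT v₀ hv₀ y v (inTube_of_inBox hK00 hy) hv u hu
  have hJUB : ∀ y v : Fin 4 → ℤ → ℝ, (∀ i k, -cd.Kb ≤ k → k ≤ cd.Ka → lo i k ≤ y i k ∧ y i k ≤ hi i k) →
      (∀ i k, -cd.Kb ≤ k → k ≤ cd.Ka → loV i k ≤ v i k ∧ v i k ≤ hiV i k) →
      ∀ i k, -cd.Kb ≤ k → k ≤ cd.Ka → |varJet cd.Qb y v (bx.pdegV + 1) i k| ≤ bx.JU j s' i k :=
    fun y v hy hv => hJUT y v (inTube_of_inBox hK00 hy) hv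
  -- window-level existence + confinement + remainder for every start of the outer hull (both test branches)
  have hwin : ∀ z, InBox cd (bx.hlo 2 j s') (bx.hhi 2 j s') z →
      IsSolOn (Qw cd) (toVec cd z) (cd.h j s') (fun s => flowSel (Qw cd) (toVec cd z) s) ∧
        (∀ u ∈ Icc 0 (cd.h j s'), flowSel (Qw cd) (toVec cd z) u ∈ Icc (toVec cd lo) (toVec cd hi)) ∧
        ∀ u ∈ Icc 0 (cd.h j s'), ∀ c, |flowSel (Qw cd) (toVec cd z) u c -
          ∑ n ∈ Finset.range (cd.pdeg + 1), taylorJet (Qw cd) (toVec cd z) n c * u ^ n| ≤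
            toVec cd (bx.J j s') c * u ^ (cd.pdeg + 1) := by
    intro z hz
    rcases hE with hE1 | hE2
    · obtain ⟨hx, henc⟩ := hE1 z hz
      obtain ⟨hsol, hbox⟩ := flowSel_isSolOn_mem_Icc hMS (toVec_mem_Icc_of_bounds (cd := cd) hx) hh'
        (roughEnclosure_toVec henc)
      refine ⟨hsol, hbox, fun u hu c => ?_⟩
      have hJ' : ∀ yv ∈ Icc (toVec cd lo) (toVec cd hi), ∀ c', |taylorJet (Qw cd) yv (cd.pdeg + 1) c'| ≤
          toVec cd (bx.J j s') c' := by
        intro yv hyv c'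
        have h1 := hJB (ofVec cd yv) (ofVec_window_bounds (cd := cd) hyv) (modeOf cd c') (shellOf cd c')
          (shellOf_mem cd c').1 (shellOf_mem cd c').2
        have h2 := congrFun (toVec_taylorJet (cd := cd) (ofVec cd yv) (cd.pdeg + 1)) c'
        rw [toVec_ofVec] at h2
        simp only [toVec] at h2 ⊢
        rw [← h2]
        exact h1
      exact abs_flowSel_sub_taylor_le hMS (toVec_mem_Icc_of_bounds (cd := cd) hx) hh' (roughEnclosure_toVec henc)
        hJ' u hu c
    · exact flowSel_window_of_hoTest hMS hh' hJB (hE2 z hz)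
  refine ⟨?_, ?_, ?_, ?_, ?_, ?_⟩
  · -- (F1′)
    intro z hz
    obtain ⟨hsol, hbox, -⟩ := hwin z hz
    refine ⟨solvesOn_of_isSolOn_flowSel hsol, fun u hu => ?_⟩
    have h1 := ofVec_window_bounds (cd := cd) (hbox u hu)
    rw [← stAt_liftFlow (Φ := fun x s => flowSel (Qw cd) x s) j z u] at h1
    exact h1
  · -- (F3′)
    intro w u₀ hu₀ hw hwbox z hz
    exact ⟨solvesOn_liftFlowSel_restart hMS hu₀ hw hwbox hz hKκ hKtestB,
      diff_bounds_liftFlowSel_restart hMS hu₀ hw hwbox hz hKκ hKtestB⟩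
  · -- (F4′)
    intro w u₀ hu₀ hw hwbox z z' dd hz hz' hdd i k hk1 hk2 t' ht'
    exact segDeriv_liftFlowSel_restart hMS hω hu₀ hw hwbox hKκ hKtestB
      (fun i k hk1 hk2 => hVincl i k hk1 hk2) hVtestT hVrow hz hz' hdd i k hk1 hk2 t' ht'
  · -- (F5′)
    intro z hz u hu i k hk1 hk2
    have hk : -cd.Kb ≤ k ∧ k ≤ cd.Ka := ⟨hk1, hk2⟩
    obtain ⟨-, -, hrem⟩ := hwin z hz
    set c : Fin (nW cd) := eW cd (i, ⟨k, Finset.mem_Icc.2 hk⟩) with hc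
    have key := hrem u hu c
    rw [stAt_liftFlow, ofVec_apply_of_mem cd _ i hk]
    have e1 : ∀ n, taylorJet (Qw cd) (toVec cd z) n c = taylorJet cd.Qb z n i k := by
      intro n
      rw [← toVec_taylorJet]
      simp [toVec, hc, modeOf, shellOf]
    have e2 : toVec cd (bx.J j s') c = bx.J j s' i k := by simp [toVec, hc, modeOf, shellOf]
    simp only [e1, e2] at key
    exact key
  · -- (F7′)
    intro zv hzv u hu
    have hsolW : ∀ yv ∈ Icc (toVec cd (bx.hlo 2 j s')) (toVec cd (bx.hhi 2 j s')),
        IsSolOn (Qw cd) yv (cd.h j s') (fun s => flowSel (Qw cd) yv s) ∧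
          ∀ u ∈ Icc 0 (cd.h j s'), flowSel (Qw cd) yv u ∈ Icc (toVec cd lo) (toVec cd hi) := by
      intro yv hyv
      have h1 := hwin _ (ofVec_window_bounds (cd := cd) hyv)
      rw [toVec_ofVec] at h1
      exact ⟨h1.1, h1.2.1⟩
    exact varTaylor_fderiv_flowSel_of_tests hMS hω hh' hsolW hVincl hVtestB hJUB hzv hu
  · -- (F8′)
    intro z z' hz hz'
    -- the derivative family on the hull box at time `h` and its column enclosure
    have hsolW : ∀ yv ∈ Icc (toVec cd (bx.hlo 2 j s')) (toVec cd (bx.hhi 2 j s')),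
        IsSolOn (Qw cd) yv (cd.h j s') (fun s => flowSel (Qw cd) yv s) ∧
          ∀ u ∈ Icc 0 (cd.h j s'), flowSel (Qw cd) yv u ∈ Icc (toVec cd lo) (toVec cd hi) := by
      intro yv hyv
      have h1 := hwin _ (ofVec_window_bounds (cd := cd) hyv)
      rw [toVec_ofVec] at h1
      exact ⟨h1.1, h1.2.1⟩
    have hhmem : cd.h j s' ∈ Icc 0 (cd.h j s') := ⟨hh', le_rfl⟩
    have hder : ∀ yv ∈ Icc (toVec cd (bx.hlo 2 j s')) (toVec cd (bx.hhi 2 j s')),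
        ∃ L : (Fin (nW cd) → ℝ) →L[ℝ] (Fin (nW cd) → ℝ),
          HasFDerivWithinAt (fun yv => flowSel (Qw cd) yv (cd.h j s')) L
            (Icc (toVec cd (bx.hlo 2 j s')) (toVec cd (bx.hhi 2 j s'))) yv ∧
          (∀ c, L (Pi.single c 1) ∈ Icc ((wW cd j c)⁻¹ • toVec cd loV) ((wW cd j c)⁻¹ • toVec cd hiV)) ∧
          ∀ c c', |L (Pi.single c 1) c' -
              ∑ n ∈ Finset.range (bx.pdegV + 1), varJet (Qw cd) yv (Pi.single c 1) n c' * cd.h j s' ^ n| ≤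
            toVec cd (bx.JU j s') c' * (wW cd j c)⁻¹ * cd.h j s' ^ (bx.pdegV + 1) :=
      fun yv hyv => varTaylor_fderiv_flowSel_of_tests hMS hω hh' hsolW hVincl hVtestB hJUB hyv hhmem
    classical
    set f' : (Fin (nW cd) → ℝ) → (Fin (nW cd) → ℝ) →L[ℝ] (Fin (nW cd) → ℝ) := fun yv =>
      if hyv : yv ∈ Icc (toVec cd (bx.hlo 2 j s')) (toVec cd (bx.hhi 2 j s')) then Classical.choose (hder yv hyv) else 0
      with hf'
    have hf'spec : ∀ yv (hyv : yv ∈ Icc (toVec cd (bx.hlo 2 j s')) (toVec cd (bx.hhi 2 j s'))),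
        HasFDerivWithinAt (fun yv => flowSel (Qw cd) yv (cd.h j s')) (f' yv)
            (Icc (toVec cd (bx.hlo 2 j s')) (toVec cd (bx.hhi 2 j s'))) yv ∧
          ∀ c c', |f' yv (Pi.single c 1) c' -
              ∑ n ∈ Finset.range (bx.pdegV + 1), varJet (Qw cd) yv (Pi.single c 1) n c' * cd.h j s' ^ n| ≤
            toVec cd (bx.JU j s') c' * (wW cd j c)⁻¹ * cd.h j s' ^ (bx.pdegV + 1) := by
      intro yv hyv
      have h1 := Classical.choose_spec (hder yv hyv)
      simp only [hf', dif_pos hyv]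
      exact ⟨h1.1, h1.2.2⟩
    -- columns inside `[Mlo, Mhi]` (read in window coordinates)
    have hcols : ∀ yv ∈ Icc (toVec cd (bx.hlo 2 j s')) (toVec cd (bx.hhi 2 j s')), ∀ c c',
        bx.Mlo j s' (modeOf cd c') (shellOf cd c') (modeOf cd c) (shellOf cd c) ≤ f' yv (Pi.single c 1) c' ∧
        f' yv (Pi.single c 1) c' ≤ bx.Mhi j s' (modeOf cd c') (shellOf cd c') (modeOf cd c) (shellOf cd c) := by
      intro yv hyv c c'
      have h1 := (hf'spec yv hyv).2 c c'
      have h2 := hM (ofVec cd yv) (ofVec_window_bounds (cd := cd) hyv) (modeOf cd c) (shellOf cd c)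
        (shellOf_mem cd c).1 (shellOf_mem cd c).2 (modeOf cd c') (shellOf cd c') (shellOf_mem cd c').1 (shellOf_mem cd c').2
      have e1 : ∀ n, varJet cd.Qb (ofVec cd yv) (basisSt (modeOf cd c) (shellOf cd c)) n (modeOf cd c') (shellOf cd c') =
          varJet (Qw cd) yv (Pi.single c 1) n c' := by
        intro n
        have h3 := congrFun (toVec_varJet (cd := cd) (ofVec cd yv) (basisSt (modeOf cd c) (shellOf cd c)) n) c'
        rw [toVec_ofVec, toVec_basisSt (cd := cd) (modeOf cd c) (shellOf_mem cd c)] at h3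
        have e2 : eW cd (modeOf cd c, ⟨shellOf cd c, Finset.mem_Icc.2 (shellOf_mem cd c)⟩) = c := by
          simp [modeOf, shellOf]
        rw [e2] at h3
        simp only [toVec] at h3
        exact h3
      have e3 : cd.ω j (shellOf cd c) = wW cd j c := rfl
      simp only [e1, e3] at h2
      have h4 := abs_le.1 h1
      simp only [toVec] at h4
      constructor <;> linarith [h2.1, h2.2, h4.1, h4.2]
    obtain ⟨A, hA, hAeq⟩ := exists_matrix_mem_Icc_of_hasFDerivWithin (convex_Icc _ _)
      (fun yv hyv => (hf'spec yv hyv).1) (Mlo := fun c' c => bx.Mlo j s' (modeOf cd c') (shellOf cd c') (modeOf cd c) (shellOf cd c))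
      (Mhi := fun c' c => bx.Mhi j s' (modeOf cd c') (shellOf cd c') (modeOf cd c) (shellOf cd c))
      (fun yv hyv c c' => hcols yv hyv c c') (toVec_mem_Icc_of_bounds (cd := cd) hz) (toVec_mem_Icc_of_bounds (cd := cd) hz')
    refine ⟨fun i' k' i k => if hk' : -cd.Kb ≤ k' ∧ k' ≤ cd.Ka then
        (if hk : -cd.Kb ≤ k ∧ k ≤ cd.Ka then A (eW cd (i', ⟨k', Finset.mem_Icc.2 hk'⟩)) (eW cd (i, ⟨k, Finset.mem_Icc.2 hk⟩)) else 0)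
        else 0, ?_, ?_⟩
    · intro i' k' hk1' hk2' i k hk1 hk2
      have hk' : -cd.Kb ≤ k' ∧ k' ≤ cd.Ka := ⟨hk1', hk2'⟩
      have hk : -cd.Kb ≤ k ∧ k ≤ cd.Ka := ⟨hk1, hk2⟩
      simp only [dif_pos hk', dif_pos hk]
      have h1 := hA (eW cd (i', ⟨k', Finset.mem_Icc.2 hk'⟩)) (eW cd (i, ⟨k, Finset.mem_Icc.2 hk⟩))
      simpa [modeOf, shellOf] using h1
    · intro i' k' hk1' hk2'
      have hk' : -cd.Kb ≤ k' ∧ k' ≤ cd.Ka := ⟨hk1', hk2'⟩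
      have h1 : flowSel (Qw cd) (toVec cd z) (cd.h j s') (eW cd (i', ⟨k', Finset.mem_Icc.2 hk'⟩)) -
          flowSel (Qw cd) (toVec cd z') (cd.h j s') (eW cd (i', ⟨k', Finset.mem_Icc.2 hk'⟩)) =
          ∑ c, A (eW cd (i', ⟨k', Finset.mem_Icc.2 hk'⟩)) c * (toVec cd z - toVec cd z') c := by
        simpa using hAeq (eW cd (i', ⟨k', Finset.mem_Icc.2 hk'⟩))
      rw [stAt_liftFlow, stAt_liftFlow, ← ofVec_sub, ofVec_apply_of_mem cd _ i' hk']
      show flowSel (Qw cd) (toVec cd z) (cd.h j s') (eW cd (i', ⟨k', Finset.mem_Icc.2 hk'⟩)) -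
          flowSel (Qw cd) (toVec cd z') (cd.h j s') (eW cd (i', ⟨k', Finset.mem_Icc.2 hk'⟩)) = _
      rw [h1, toVec_sub]
      refine Finset.sum_congr rfl fun c _ => ?_
      simp only [dif_pos hk', dif_pos (shellOf_mem cd c)]
      congr 1
      have e2 : eW cd (modeOf cd c, ⟨shellOf cd c, Finset.mem_Icc.2 (shellOf_mem cd c)⟩) = c := by
        simp [modeOf, shellOf]
      rw [e2]

end Summit.NavierStokesRegularity.NavierStokesRegularity.Theorems.TaylorModelV

end
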